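import Summits.MatrixMultiplication.MatrixMultiplication.Theorems.SaturationLadderHeightGrades
import Mathlib.Analysis.Convex.Jensen
import Mathlib.Analysis.Convex.SpecificFunctions.Basic
import HarnessLib

/-!
# Route `SaturationLadder` on Strassen's spectrum, XIV: PERFECT PACKINGS — the certificates that reach the corner cone

decomp-mm lens 1 «grading / quantitative ladder», gen 48, kernel K48-P.  Def-free, sorry-free support module beneath the
deciding crux `SubexpSaturation` (stmt-MatrixMultiplication-25909) of `route-MatrixMultiplication-SaturationLadder`; cut of
record UNCHANGED (`closes (h₁ : SubexpSaturation) (h₂ : SubexpToPoly) (h₃ : PolyToFinite) (h₄ : TailDescentTwo)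
(h₅ : SquareFromTwo)`).  `θ = specMMPoint K φ ∈ [0,1]³` (Alman–Li 2026, Prop. 4.1/4.2), `εᵢ = 1 − θᵢ`, `V = (1,0,1)`.

DIAGNOSIS (memo NODE-SaturationLadder-g48 §2).  By the thin roof (K43-A `thinTight_iff_roof`) `h₁` is a family of
half-spaces `t·θ₁ ≤ ε₀ + r·ε₂` THROUGH `V`: a statement about the closed convex cone of `specMM − V`.  Far rates and
height grades (gens 39–47) are POINT data — suprema over the body mixing direction with distance — and hold in "dust"
spectra `V + λₙ(−u,v,−1/n)`, `λₙ → 0` fast, that admit no roof `t > u/v`.  A certificate `bR(⊕ᵢ⟨aᵢ,bᵢ,cᵢ⟩) ≤ ρ` reads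
`∑ᵢ aᵢ^θ₀bᵢ^θ₁cᵢ^θ₂ ≤ ρ`, a convex constraint whose boundary passes through `V` iff `ρ = ∑ᵢ aᵢcᵢ` (OUTPUT-PERFECT:
border rank = number of output entries); otherwise it contains a neighbourhood of `V` and says nothing about the cone.
* §1 **DEFECT ROOF** (`defectRoof_of_readout`, every field; Jensen for `exp` = Gibbs' inequality at `V`): a readout
  `∑ᵢ φ(⟨aᵢ,bᵢ,cᵢ⟩) ≤ ρ` forces `B·θ₁ ≤ A·ε₀ + C·ε₂ + W·log(ρ/W)`, `W = ∑ aᵢcᵢ`, `(A,B,C) = ∑ aᵢcᵢ(log aᵢ, log bᵢ, log cᵢ)`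
  — Coppersmith's 1982 type selection (BCS Thm. (15.51)) in spectral form for an arbitrary direct sum; perfect case
  `ρ = W`: the EXACT thin tight point `ω(1, B/A, C/A) ≤ 1 + C/A` (`thinTight_of_perfectReadout`).
* §2 readout from a certificate: `∑ᵢ φ(blockᵢ) ≤ φ(⊕ blocks) ≤ R̃ ≤ bR` (`sum_map_le_map_matMulDirectSum`, the other
  half of the tree's `IsUniversalSpectralPoint.matMulDirectSum_le_sum`; `thinTight_of_perfectBorderRank`).
* §3 certificates reach the cone iff their NORMALISED DEFECT `log(ρ/W)/A` tends to `0` (`thinTight_of_defectRoofs`,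
  `thinTight_of_defectCertificates`); Kronecker powers keep it constant, so one imperfect certificate proves no roof.
* §4 **ROOF LADDER ⟹ h₁** (`subexpSaturation_of_roofSequence`, `ℂ`): exact thin roofs `(tₙ,rₙ)`, `tₙ ↑ 1`,
  `(1−tₙ)·log r_{n+1} → 0` ⟹ `SubexpSaturation`; with §2, `subexpSaturation_of_perfectPackings` (SUFF).
* §5 first instance: route `FarEdgeDescent`'s isolated base `⟨1,4,1⟩ ⊕ ⟨3,1,3⟩`, `bR ≤ 10 = 1 + 9` outputs (XXXII-D
  `base_isolated`) ⟹ `ω(1, log 4/(9 log 3), 1) = 2` over every field (`0.1402`, below the tree's Coppersmith `0.1722`).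
Tags: `SubexpSaturation` (h₁) · SUFF (perfect packings ⟹ roofs ⟹ h₁) · EQUIV re-typing (defect certificates, memo). No defs.
[cite: Coppersmith1982, Theorem (BCS 1997 Thm. (15.51))] [cite: Schonhage1981, §5] [cite: Strassen1988, Thm. 3.8]
[cite: AlmanLi2026, Proposition 4.1, 4.2] [cite: ChristandlVranaZuiddam2023, §1.2] [cite: LottiRomani1983, §2]
-/

set_option linter.dupNamespace false

noncomputable section

open scoped BigOperators

namespace Summit.MatrixMultiplication.MatrixMultiplication.Theorems.SaturationLadderPerfectPacking

open Literature.Computability.AlgebraicComplexity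
open Summit.MatrixMultiplication.MatrixMultiplication.Theses.SaturationLadder
open Summit.MatrixMultiplication.MatrixMultiplication.Theorems.SaturationLadderThinRoof

variable {K : Type} [Field K]

/-! ## §1 The defect roof: Gibbs' inequality at the output corner -/

/-- **Prop. 4.1 at the corner** `V = (1,0,1)`: `φ(⟨a,b,c⟩) = a^θ₀b^θ₁c^θ₂ = (ac)·exp((θ₀−1)log a + θ₁log b + (θ₂−1)log c)`.
[cite: AlmanLi2026, Proposition 4.1] -/
theorem map_block_eq {F : SpectralMap K} (hF : IsUniversalSpectralPoint K F) {a b c : ℕ} (ha : 1 ≤ a)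
    (hb : 1 ≤ b) (hc : 1 ≤ c) :
    F (matMulTensor K a b c) = ((a : ℝ) * c) * Real.exp ((specMMPoint K F 0 - 1) * Real.log a +
      specMMPoint K F 1 * Real.log b + (specMMPoint K F 2 - 1) * Real.log c) := by
  have ha0 : (0 : ℝ) < a := by exact_mod_cast ha
  have hb0 : (0 : ℝ) < b := by exact_mod_cast hb
  have hc0 : (0 : ℝ) < c := by exact_mod_cast hc
  have hac : (a : ℝ) * c = Real.exp (Real.log a + Real.log c) := by
    rw [Real.exp_add, Real.exp_log ha0, Real.exp_log hc0]
  rw [AlmanLi2026.prop41 hF ha hb hc, Real.rpow_def_of_pos ha0, Real.rpow_def_of_pos hb0,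
    Real.rpow_def_of_pos hc0, ← Real.exp_add, ← Real.exp_add, hac, ← Real.exp_add]
  congr 1
  ring

/-- **THE DEFECT ROOF** (Gibbs / Jensen at the output corner).  A readout `∑ᵢ φ(⟨aᵢ,bᵢ,cᵢ⟩) ≤ ρ` of a universal
spectral point on positive formats forces, with `W = ∑ aᵢcᵢ` (output count) and the OUTPUT-WEIGHTED LOG-SHAPE
`A = ∑ aᵢcᵢ log aᵢ`, `B = ∑ aᵢcᵢ log bᵢ`, `C = ∑ aᵢcᵢ log cᵢ`:  `B·θ₁ ≤ A·(1−θ₀) + C·(1−θ₂) + W·log(ρ/W)`.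
Proof: `exp(∑ πᵢΔᵢ) ≤ ∑ πᵢ exp Δᵢ = (∑ φ(blockᵢ))/W ≤ ρ/W`, `πᵢ = aᵢcᵢ/W` (Coppersmith's type selection is its shadow).
[cite: Coppersmith1982, Theorem (BCS 1997 Thm. (15.51), proof)] [cite: AlmanLi2026, Proposition 4.1] -/
theorem defectRoof_of_readout {p : ℕ} {a b c : Fin p → ℕ} (hpos : ∀ i, 1 ≤ a i ∧ 1 ≤ b i ∧ 1 ≤ c i)
    (hp : 0 < p) {F : SpectralMap K} (hF : IsUniversalSpectralPoint K F) {ρ : ℝ}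
    (hread : ∑ i, F (matMulTensor K (a i) (b i) (c i)) ≤ ρ) :
    (∑ i, (a i : ℝ) * c i * Real.log (b i)) * specMMPoint K F 1 ≤
      (∑ i, (a i : ℝ) * c i * Real.log (a i)) * (1 - specMMPoint K F 0) +
      (∑ i, (a i : ℝ) * c i * Real.log (c i)) * (1 - specMMPoint K F 2) +
      (∑ i, (a i : ℝ) * c i) * Real.log (ρ / ∑ i, (a i : ℝ) * c i) := by
  classical
  haveI : Nonempty (Fin p) := ⟨⟨0, hp⟩⟩
  set θ := specMMPoint K F with hθ
  set W : ℝ := ∑ i, (a i : ℝ) * c i with hW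
  set Δ : Fin p → ℝ := fun i =>
    (θ 0 - 1) * Real.log (a i) + θ 1 * Real.log (b i) + (θ 2 - 1) * Real.log (c i) with hΔ
  have hx : ∀ i, (0 : ℝ) < (a i : ℝ) * c i := fun i =>
    mul_pos (by exact_mod_cast (hpos i).1) (by exact_mod_cast (hpos i).2.2)
  have hWpos : 0 < W := Finset.sum_pos (fun i _ => hx i) Finset.univ_nonempty
  have hblock : ∀ i, F (matMulTensor K (a i) (b i) (c i)) = (a i : ℝ) * c i * Real.exp (Δ i) :=
    fun i => map_block_eq hF (hpos i).1 (hpos i).2.1 (hpos i).2.2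
  have hρ : 0 < ρ := lt_of_lt_of_le (Finset.sum_pos (fun i _ => lt_of_lt_of_le one_pos
    (hF.one_le_map_matMulTensor (hpos i).1 (hpos i).2.1 (hpos i).2.2)) Finset.univ_nonempty) hread
  have hJ : Real.exp (∑ i, (a i : ℝ) * c i / W * Δ i) ≤ ∑ i, (a i : ℝ) * c i / W * Real.exp (Δ i) := by
    simpa only [smul_eq_mul] using convexOn_exp.map_sum_le (t := Finset.univ)
      (w := fun i => (a i : ℝ) * c i / W) (p := Δ) (fun i _ => div_nonneg (hx i).le hWpos.le)
      (by rw [← Finset.sum_div]; exact div_self hWpos.ne') (fun i _ => Set.mem_univ _)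
  have hrhs : ∑ i, (a i : ℝ) * c i / W * Real.exp (Δ i) = (∑ i, F (matMulTensor K (a i) (b i) (c i))) / W := by
    rw [Finset.sum_div]
    exact Finset.sum_congr rfl fun i _ => by rw [hblock i, div_mul_eq_mul_div]
  have hlhs : ∑ i, (a i : ℝ) * c i / W * Δ i = (∑ i, (a i : ℝ) * c i * Δ i) / W := by
    rw [Finset.sum_div]
    exact Finset.sum_congr rfl fun i _ => by rw [div_mul_eq_mul_div]
  have hlog : (∑ i, (a i : ℝ) * c i * Δ i) / W ≤ Real.log (ρ / W) := by
    rw [← Real.exp_le_exp, Real.exp_log (div_pos hρ hWpos), ← hlhs]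
    exact hJ.trans (by rw [hrhs]; exact div_le_div_of_nonneg_right hread hWpos.le)
  rw [div_le_iff₀ hWpos] at hlog
  have hexpand : ∑ i, (a i : ℝ) * c i * Δ i =
      (θ 0 - 1) * ∑ i, (a i : ℝ) * c i * Real.log (a i) + θ 1 * ∑ i, (a i : ℝ) * c i * Real.log (b i) +
        (θ 2 - 1) * ∑ i, (a i : ℝ) * c i * Real.log (c i) := by
    simp only [hΔ, Finset.mul_sum, ← Finset.sum_add_distrib]
    exact Finset.sum_congr rfl fun i _ => by ring
  rw [hexpand] at hlog
  have hcomm : Real.log (ρ / W) * W = W * Real.log (ρ / W) := mul_comm _ _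
  linarith

/-- **PERFECT READOUT ⟹ EXACT ROOF**: if `∑ᵢ φ(⟨aᵢ,bᵢ,cᵢ⟩) ≤ ∑ᵢ aᵢcᵢ` for every universal `φ` (OUTPUT-PERFECT on the
spectrum), then `B·θ₁ ≤ A·ε₀ + C·ε₂`. [cite: Coppersmith1982, Theorem (BCS 1997 Thm. (15.51))] [cite: Strassen1988, Thm. 3.8] -/
theorem weightedRoof_of_perfectReadout {p : ℕ} {a b c : Fin p → ℕ} (hpos : ∀ i, 1 ≤ a i ∧ 1 ≤ b i ∧ 1 ≤ c i)
    (hp : 0 < p) (hread : ∀ F : SpectralMap K, IsUniversalSpectralPoint K F →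
      ∑ i, F (matMulTensor K (a i) (b i) (c i)) ≤ ∑ i, (a i : ℝ) * c i)
    {F : SpectralMap K} (hF : IsUniversalSpectralPoint K F) :
    (∑ i, (a i : ℝ) * c i * Real.log (b i)) * specMMPoint K F 1 ≤
      (∑ i, (a i : ℝ) * c i * Real.log (a i)) * (1 - specMMPoint K F 0) +
      (∑ i, (a i : ℝ) * c i * Real.log (c i)) * (1 - specMMPoint K F 2) := by
  haveI : Nonempty (Fin p) := ⟨⟨0, hp⟩⟩
  have hWpos : 0 < ∑ i, (a i : ℝ) * c i := Finset.sum_pos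
    (fun i _ => mul_pos (by exact_mod_cast (hpos i).1) (by exact_mod_cast (hpos i).2.2)) Finset.univ_nonempty
  have h := defectRoof_of_readout hpos hp hF (hread F hF)
  rwa [div_self hWpos.ne', Real.log_one, mul_zero, add_zero] at h

/-- The log-shape sums are nonnegative (formats `≥ 1`). [folklore] -/
theorem shapeSum_nonneg {p : ℕ} {a c : Fin p → ℕ} (x : Fin p → ℕ) (hx : ∀ i, 1 ≤ x i) :
    0 ≤ ∑ i, (a i : ℝ) * c i * Real.log (x i) :=
  Finset.sum_nonneg fun i _ => mul_nonneg (mul_nonneg (Nat.cast_nonneg _) (Nat.cast_nonneg _))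
    (Real.log_nonneg (by exact_mod_cast hx i))

/-- **PERFECT READOUT ⟹ EXACT THIN TIGHT POINT AT THE OUTPUT-WEIGHTED MEAN SHAPE**: with `A > 0`,
`ω_K(1, B/A, C/A) ≤ 1 + C/A` (`= 1 + C/A` when `C ≥ A`, flattening): every output-perfect direct sum is an exact
point of the rectangular exponent curve. [cite: Coppersmith1982, Theorem (BCS 1997 Thm. (15.51))]
[cite: Strassen1988, Thm. 3.8] [cite: LottiRomani1983, §2] -/
theorem thinTight_of_perfectReadout {p : ℕ} {a b c : Fin p → ℕ} (hpos : ∀ i, 1 ≤ a i ∧ 1 ≤ b i ∧ 1 ≤ c i)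
    (hp : 0 < p) (hread : ∀ F : SpectralMap K, IsUniversalSpectralPoint K F →
      ∑ i, F (matMulTensor K (a i) (b i) (c i)) ≤ ∑ i, (a i : ℝ) * c i)
    (hA : 0 < ∑ i, (a i : ℝ) * c i * Real.log (a i)) :
    omegaRect K 1 ((∑ i, (a i : ℝ) * c i * Real.log (b i)) / ∑ i, (a i : ℝ) * c i * Real.log (a i))
        ((∑ i, (a i : ℝ) * c i * Real.log (c i)) / ∑ i, (a i : ℝ) * c i * Real.log (a i)) ≤
      1 + (∑ i, (a i : ℝ) * c i * Real.log (c i)) / ∑ i, (a i : ℝ) * c i * Real.log (a i) := by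
  set A := ∑ i, (a i : ℝ) * c i * Real.log (a i) with hAdef
  set B := ∑ i, (a i : ℝ) * c i * Real.log (b i) with hBdef
  set C := ∑ i, (a i : ℝ) * c i * Real.log (c i) with hCdef
  have hB : 0 ≤ B := shapeSum_nonneg b fun i => (hpos i).2.1
  have hC : 0 ≤ C := shapeSum_nonneg c fun i => (hpos i).2.2
  rw [thinTight_iff_roof (div_nonneg hB hA.le) (div_nonneg hC hA.le)]
  intro F hF
  have hA0 : A ≠ 0 := hA.ne'
  rw [div_mul_eq_mul_div, div_le_iff₀ hA]
  calc B * specMMPoint K F 1 ≤ A * (1 - specMMPoint K F 0) + C * (1 - specMMPoint K F 2) :=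
        weightedRoof_of_perfectReadout hpos hp hread hF
    _ = ((1 - specMMPoint K F 0) + C / A * (1 - specMMPoint K F 2)) * A := by field_simp

/-! ## §2 The readout from a border-rank certificate -/

/-- **The blocks of a direct sum add up below it on the spectrum**: `∑ᵢ φ(⟨kᵢ,mᵢ,nᵢ⟩) ≤ φ(⊕ᵢ⟨kᵢ,mᵢ,nᵢ⟩)` for a
universal spectral point (relabelling `⟨k₀,m₀,n₀⟩ ⊕ (⊕_{i<q}⟨k_{i+1},…⟩) ≤ ⊕_{i<q+1}⟨kᵢ,…⟩` and additivity; with the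
tree's `IsUniversalSpectralPoint.matMulDirectSum_le_sum` this is equality). [cite: ChristandlVranaZuiddam2023, §1.2] -/
theorem sum_map_le_map_matMulDirectSum {F : SpectralMap K} (hF : IsUniversalSpectralPoint K F) :
    ∀ {q : ℕ} (k m n : Fin q → ℕ), ∑ i, F (matMulTensor K (k i) (m i) (n i)) ≤ F (matMulDirectSum K k m n) := by
  intro q
  induction q with
  | zero =>
    intro k m n
    rw [Finset.univ_eq_empty, Finset.sum_empty]
    exact hF.nonneg _
  | succ q ih =>
    intro k m n
    classical
    let gZ : (Fin (k 0) × Fin (n 0)) ⊕ (Σ i : Fin q, Fin (k i.succ) × Fin (n i.succ)) →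
        (Σ i : Fin (q + 1), Fin (k i) × Fin (n i)) := Sum.elim (fun pr => ⟨0, pr⟩) (fun x => ⟨x.1.succ, x.2⟩)
    let gX : (Fin (k 0) × Fin (m 0)) ⊕ (Σ i : Fin q, Fin (k i.succ) × Fin (m i.succ)) →
        (Σ i : Fin (q + 1), Fin (k i) × Fin (m i)) := Sum.elim (fun pr => ⟨0, pr⟩) (fun x => ⟨x.1.succ, x.2⟩)
    let gY : (Fin (m 0) × Fin (n 0)) ⊕ (Σ i : Fin q, Fin (m i.succ) × Fin (n i.succ)) →
        (Σ i : Fin (q + 1), Fin (m i) × Fin (n i)) := Sum.elim (fun pr => ⟨0, pr⟩) (fun x => ⟨x.1.succ, x.2⟩)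
    have key : directSumTensor (matMulTensor K (k 0) (m 0) (n 0))
          (matMulDirectSum K (fun i => k i.succ) (fun i => m i.succ) (fun i => n i.succ)) =
        fun u v w => matMulDirectSum K k m n (gZ u) (gX v) (gY w) := by
      funext u v w
      rcases u with pa | ⟨j, pa⟩ <;> rcases v with pb | ⟨j', pb⟩ <;> rcases w with pc | ⟨j'', pc⟩
      · simp [gZ, gX, gY, matMulDirectSum, matMulTensor, directSumTensor, Fin.ext_iff]
      · simp [gZ, gX, gY, matMulDirectSum, directSumTensor, (Fin.succ_ne_zero j'').symm]
      · simp [gZ, gX, gY, matMulDirectSum, directSumTensor, (Fin.succ_ne_zero j').symm]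
      · simp [gZ, gX, gY, matMulDirectSum, directSumTensor, (Fin.succ_ne_zero j').symm]
      · simp [gZ, gX, gY, matMulDirectSum, directSumTensor, Fin.succ_ne_zero j]
      · simp [gZ, gX, gY, matMulDirectSum, directSumTensor, Fin.succ_ne_zero j]
      · simp [gZ, gX, gY, matMulDirectSum, directSumTensor, Fin.succ_ne_zero j']
      · simp [gZ, gX, gY, matMulDirectSum, directSumTensor, Fin.succ_inj]
    have hres : TensorRestrictsTo (matMulDirectSum K k m n) (directSumTensor (matMulTensor K (k 0) (m 0) (n 0))
          (matMulDirectSum K (fun i => k i.succ) (fun i => m i.succ) (fun i => n i.succ))) := by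
      rw [key]
      exact tensorRestrictsTo_precomp _ _ _ _
    calc ∑ i, F (matMulTensor K (k i) (m i) (n i))
        = F (matMulTensor K (k 0) (m 0) (n 0)) + ∑ i : Fin q, F (matMulTensor K (k i.succ) (m i.succ) (n i.succ)) :=
          Fin.sum_univ_succ fun i => F (matMulTensor K (k i) (m i) (n i))
      _ ≤ F (matMulTensor K (k 0) (m 0) (n 0)) +
            F (matMulDirectSum K (fun i => k i.succ) (fun i => m i.succ) (fun i => n i.succ)) :=
          add_le_add le_rfl (ih _ _ _)
      _ = F (directSumTensor (matMulTensor K (k 0) (m 0) (n 0))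
            (matMulDirectSum K (fun i => k i.succ) (fun i => m i.succ) (fun i => n i.succ))) :=
          (hF.map_directSum _ _).symm
      _ ≤ F (matMulDirectSum K k m n) := hF.mono _ _ hres

/-- **Readout from a border-rank certificate**: `bR(⊕ᵢ⟨kᵢ,mᵢ,nᵢ⟩) ≤ r ⟹ ∑ᵢ φ(⟨kᵢ,mᵢ,nᵢ⟩) ≤ r` for every universal
spectral point (`φ ≤ R̃ ≤ bR`: the tree's `strassen_duality_asymptoticRank_holds`, BCS Lemma (15.27)).
[cite: Strassen1988, Thm. 3.8] [cite: BurgisserClausenShokrollahi1997, Lemma (15.27)] -/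
theorem sum_map_le_of_algBorderRank_le {F : SpectralMap K} (hF : IsUniversalSpectralPoint K F) {q : ℕ}
    (k m n : Fin q → ℕ) {r : ℕ} (hr : algBorderRank (matMulDirectSum K k m n) ≤ r) :
    ∑ i, F (matMulTensor K (k i) (m i) (n i)) ≤ r := by
  classical
  exact (sum_map_le_map_matMulDirectSum hF k m n).trans (((strassen_duality_asymptoticRank_holds K
    (matMulDirectSum K k m n)).1 F hF).trans (asymptoticRank_le_of_algBorderRank_le hr))

/-- **THE DEFECT ROOF OF A CERTIFICATE**: `bR(⊕ᵢ⟨aᵢ,bᵢ,cᵢ⟩) ≤ r` gives `B·θ₁ ≤ A·ε₀ + C·ε₂ + W·log(r/W)` for every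
universal `φ` over `K` (`W ≤ r` by flattening, so the defect is `≥ 0`; it vanishes iff the certificate is output-perfect).
[cite: Coppersmith1982, Theorem (BCS 1997 Thm. (15.51))] [cite: Strassen1988, Thm. 3.8] -/
theorem defectRoof_of_algBorderRank_le {p : ℕ} {a b c : Fin p → ℕ} (hpos : ∀ i, 1 ≤ a i ∧ 1 ≤ b i ∧ 1 ≤ c i)
    (hp : 0 < p) {r : ℕ} (hr : algBorderRank (matMulDirectSum K a b c) ≤ r)
    {F : SpectralMap K} (hF : IsUniversalSpectralPoint K F) :
    (∑ i, (a i : ℝ) * c i * Real.log (b i)) * specMMPoint K F 1 ≤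
      (∑ i, (a i : ℝ) * c i * Real.log (a i)) * (1 - specMMPoint K F 0) +
      (∑ i, (a i : ℝ) * c i * Real.log (c i)) * (1 - specMMPoint K F 2) +
      (∑ i, (a i : ℝ) * c i) * Real.log (r / ∑ i, (a i : ℝ) * c i) :=
  defectRoof_of_readout hpos hp hF (sum_map_le_of_algBorderRank_le hF a b c hr)

/-- **OUTPUT-PERFECT CERTIFICATE ⟹ EXACT THIN TIGHT POINT**: `bR(⊕ᵢ⟨aᵢ,bᵢ,cᵢ⟩) ≤ ∑ᵢ aᵢcᵢ` (border rank = number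
of output entries) and `A > 0` give `ω_K(1, B/A, C/A) ≤ 1 + C/A`. [cite: Coppersmith1982, Theorem (BCS 1997 Thm. (15.51))]
[cite: Schonhage1981, §5] [cite: Strassen1988, Thm. 3.8] -/
theorem thinTight_of_perfectBorderRank {p : ℕ} {a b c : Fin p → ℕ} (hpos : ∀ i, 1 ≤ a i ∧ 1 ≤ b i ∧ 1 ≤ c i)
    (hp : 0 < p) (hr : algBorderRank (matMulDirectSum K a b c) ≤ ∑ i, a i * c i)
    (hA : 0 < ∑ i, (a i : ℝ) * c i * Real.log (a i)) :
    omegaRect K 1 ((∑ i, (a i : ℝ) * c i * Real.log (b i)) / ∑ i, (a i : ℝ) * c i * Real.log (a i))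
        ((∑ i, (a i : ℝ) * c i * Real.log (c i)) / ∑ i, (a i : ℝ) * c i * Real.log (a i)) ≤
      1 + (∑ i, (a i : ℝ) * c i * Real.log (c i)) / ∑ i, (a i : ℝ) * c i * Real.log (a i) := by
  refine thinTight_of_perfectReadout hpos hp (fun F hF => ?_) hA
  have h := sum_map_le_of_algBorderRank_le hF a b c hr
  push_cast at h
  exact h

/-! ## §3 Certificates reach the corner cone iff their normalised defect tends to zero -/

/-- **Roofs are closed under vanishing defect**: if for every `δ > 0` every universal `φ` obeys
`t·θ₁ ≤ ε₀ + r·ε₂ + δ`, then `ω(1,t,r) ≤ 1 + r`. [cite: Strassen1988, Thm. 3.8] [cite: LottiRomani1983, §2] -/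
theorem thinTight_of_defectRoofs {t r : ℝ} (ht : 0 ≤ t) (hr : 0 ≤ r)
    (h : ∀ δ : ℝ, 0 < δ → ∀ F : SpectralMap K, IsUniversalSpectralPoint K F →
      t * specMMPoint K F 1 ≤ (1 - specMMPoint K F 0) + r * (1 - specMMPoint K F 2) + δ) :
    omegaRect K 1 t r ≤ 1 + r :=
  (thinTight_iff_roof ht hr).2 fun F hF => le_of_forall_pos_le_add fun δ hδ => h δ hδ F hF

/-- **THE CERTIFICATE FORM OF A THIN TIGHT POINT.**  `ω_K(1,t,r) ≤ 1 + r` as soon as, for every `δ > 0`, some direct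
sum `⊕ᵢ⟨aᵢ,bᵢ,cᵢ⟩` with a spectral readout `∑ᵢ φ(blockᵢ) ≤ ρ` has output-weighted shape `t ≤ B/A`, `C/A ≤ r` and
NORMALISED LOG-SLACK `W·log(ρ/W) ≤ δ·A`: the defects must tend to zero — one imperfect certificate and all its Kronecker
powers (`log(ρ/W)/A` is power-invariant) prove no roof (conversely the powers of one block re-type any tight point — memo).
[cite: Coppersmith1982, Theorem (BCS 1997 Thm. (15.51))] [cite: Strassen1988, Thm. 3.8] -/
theorem thinTight_of_defectCertificates {t r : ℝ} (ht : 0 ≤ t) (hr : 0 ≤ r)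
    (h : ∀ δ : ℝ, 0 < δ → ∃ (p : ℕ) (a b c : Fin p → ℕ) (ρ : ℝ), 0 < p ∧ (∀ i, 1 ≤ a i ∧ 1 ≤ b i ∧ 1 ≤ c i) ∧
      (∀ F : SpectralMap K, IsUniversalSpectralPoint K F → ∑ i, F (matMulTensor K (a i) (b i) (c i)) ≤ ρ) ∧
      0 < ∑ i, (a i : ℝ) * c i * Real.log (a i) ∧
      t * ∑ i, (a i : ℝ) * c i * Real.log (a i) ≤ ∑ i, (a i : ℝ) * c i * Real.log (b i) ∧
      ∑ i, (a i : ℝ) * c i * Real.log (c i) ≤ r * ∑ i, (a i : ℝ) * c i * Real.log (a i) ∧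
      (∑ i, (a i : ℝ) * c i) * Real.log (ρ / ∑ i, (a i : ℝ) * c i) ≤ δ * ∑ i, (a i : ℝ) * c i * Real.log (a i)) :
    omegaRect K 1 t r ≤ 1 + r := by
  refine thinTight_of_defectRoofs ht hr fun δ hδ F hF => ?_
  obtain ⟨p, a, b, c, ρ, hp, hpos, hread, hA, htA, hCr, hslack⟩ := h δ hδ
  have hroof := defectRoof_of_readout hpos hp hF (hread F hF)
  have h1 := mul_le_mul_of_nonneg_right htA (AlmanLi2026.prop42_mem_Icc hF 1).1
  have h2 := mul_le_mul_of_nonneg_right hCr (sub_nonneg.2 (AlmanLi2026.prop42_mem_Icc hF 2).2)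
  have key : (∑ i, (a i : ℝ) * c i * Real.log (a i)) * (t * specMMPoint K F 1) ≤
      (∑ i, (a i : ℝ) * c i * Real.log (a i)) *
        ((1 - specMMPoint K F 0) + r * (1 - specMMPoint K F 2) + δ) := by
    linarith
  exact le_of_mul_le_mul_left key hA

/-! ## §4 From a ladder of exact thin roofs to the crux -/

/-- **ROOF LADDER ⟹ `SubexpSaturation`.**  Exact thin tight points `ω_ℂ(1,tₙ,rₙ) ≤ 1+rₙ` with `tₙ ↑`, `tₙ < 1`,
`tₙ → 1`, `rₙ ≥ 1` and `(1 − tₙ)·log r_{n+1} → 0` prove the crux: for `t ∈ [tₙ, t_{n+1})` use `r_{n+1}` (`roof_mono`)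
and `log r_{n+1} ≤ c/(1−tₙ) ≤ c/(1−t)`.  The adapter through which any construction of output-perfect packings with
thin shapes closes `h₁`. [cite: LottiRomani1983, §2] [cite: Strassen1988, Thm. 3.8] -/
theorem subexpSaturation_of_roofSequence (t r : ℕ → ℝ) (hmono : Monotone t) (ht1 : ∀ n, t n < 1)
    (htend : ∀ s : ℝ, s < 1 → ∃ n, s < t n) (hr1 : ∀ n, 1 ≤ r n)
    (hroof : ∀ n, omegaRect ℂ 1 (t n) (r n) ≤ 1 + r n)
    (hgap : ∀ c : ℝ, 0 < c → ∃ N : ℕ, ∀ n, N ≤ n → (1 - t n) * Real.log (r (n + 1)) ≤ c) :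
    SubexpSaturation := by
  classical
  intro c hc
  obtain ⟨N, hN⟩ := hgap c hc
  refine ⟨max (t N) 0, max_lt (ht1 N) one_pos, fun s hs hs1 => ?_⟩
  have hsN : t N ≤ s := le_trans (le_max_left _ _) hs
  have hs0 : 0 ≤ s := le_trans (le_max_right _ _) hs
  have hex : ∃ n, s < t (n + 1) := by
    obtain ⟨m, hm⟩ := htend s hs1
    rcases Nat.eq_zero_or_pos m with h0 | h0
    · subst h0
      exact ⟨0, lt_of_lt_of_le hm (hmono (Nat.zero_le 1))⟩
    · exact ⟨m - 1, by rwa [Nat.sub_add_cancel h0]⟩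
  set n := Nat.find hex with hn
  have hsn1 : s < t (n + 1) := Nat.find_spec hex
  have htn : t n ≤ s := by
    rcases Nat.eq_zero_or_pos n with h0 | h0
    · rw [h0]
      exact le_trans (hmono (Nat.zero_le N)) hsN
    · have hmin := Nat.find_min hex (show n - 1 < n by omega)
      rwa [Nat.sub_add_cancel h0, not_lt] at hmin
  have hNn : N ≤ n := by
    by_contra hlt
    have h1 : t (n + 1) ≤ t N := hmono (by omega)
    linarith
  have hrpos : 0 < r (n + 1) := lt_of_lt_of_le one_pos (hr1 _)
  have h1n : 0 < 1 - t n := by linarith [ht1 n]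
  refine ⟨r (n + 1), hr1 _, ?_, ?_⟩
  · -- `r_{n+1} ≤ exp(c/(1−s))`
    have hlog : Real.log (r (n + 1)) ≤ c / (1 - t n) := by
      rw [le_div_iff₀ h1n, mul_comm]
      exact hN n hNn
    have hmon : c / (1 - t n) ≤ c / (1 - s) := div_le_div_of_nonneg_left hc.le (by linarith) (by linarith)
    calc r (n + 1) = Real.exp (Real.log (r (n + 1))) := (Real.exp_log hrpos).symm
      _ ≤ Real.exp (c / (1 - s)) := Real.exp_le_exp.2 (hlog.trans hmon)
  · -- the roof at `(t_{n+1}, r_{n+1})` covers `(s, r_{n+1})`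
    have hR := (thinTight_iff_roof (K := ℂ) (hs0.trans hsn1.le) hrpos.le).1 (hroof (n + 1))
    exact (thinTight_iff_roof hs0 hrpos.le).2 fun F hF => roof_mono hF hsn1.le le_rfl (hR F hF)

/-- **PERFECT PACKINGS ⟹ h₁** (the typed SUFF route of gen 48).  OUTPUT-PERFECT direct sums `Dₙ = ⊕ᵢ⟨aᵢ,bᵢ,cᵢ⟩` over
`ℂ` (`bR(Dₙ) ≤ ∑ aᵢcᵢ`) whose output-weighted shapes `tₙ = Bₙ/Aₙ ↑ 1` (`tₙ < 1`), `rₙ = Cₙ/Aₙ ≥ 1` satisfy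
`(1 − tₙ)·log r_{n+1} → 0` prove `SubexpSaturation` (known perfect sums have small `tₙ`; the crux here is THIN perfect families).
[cite: Coppersmith1982, Theorem (BCS 1997 Thm. (15.51))] [cite: Schonhage1981, §5] [cite: Strassen1988, Thm. 3.8] -/
theorem subexpSaturation_of_perfectPackings (p : ℕ → ℕ) (a b c : (n : ℕ) → Fin (p n) → ℕ)
    (hp : ∀ n, 0 < p n) (hpos : ∀ n i, 1 ≤ a n i ∧ 1 ≤ b n i ∧ 1 ≤ c n i)
    (hperf : ∀ n, algBorderRank (matMulDirectSum ℂ (a n) (b n) (c n)) ≤ ∑ i, a n i * c n i)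
    (hA : ∀ n, 0 < ∑ i, (a n i : ℝ) * c n i * Real.log (a n i)) (t r : ℕ → ℝ)
    (ht : ∀ n, t n = (∑ i, (a n i : ℝ) * c n i * Real.log (b n i)) / ∑ i, (a n i : ℝ) * c n i * Real.log (a n i))
    (hr : ∀ n, r n = (∑ i, (a n i : ℝ) * c n i * Real.log (c n i)) / ∑ i, (a n i : ℝ) * c n i * Real.log (a n i))
    (hmono : Monotone t) (ht1 : ∀ n, t n < 1) (htend : ∀ s : ℝ, s < 1 → ∃ n, s < t n) (hr1 : ∀ n, 1 ≤ r n)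
    (hgap : ∀ c : ℝ, 0 < c → ∃ N : ℕ, ∀ n, N ≤ n → (1 - t n) * Real.log (r (n + 1)) ≤ c) :
    SubexpSaturation :=
  subexpSaturation_of_roofSequence t r hmono ht1 htend hr1
    (fun n => by rw [ht n, hr n]; exact thinTight_of_perfectBorderRank (hpos n) (hp n) (hperf n) (hA n)) hgap

/-! ## §5 The first instance: Schönhage's `E₃` with an isolated anchor is output-perfect -/

/-- **Readout of the isolated base** of route `FarEdgeDescent`'s tower (XXXII-D `base_isolated`: `bR(⟨1,4,1⟩ ⊕ ⟨3,1,3⟩)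
≤ 10`): `φ(⟨1,4,1⟩) + φ(⟨3,1,3⟩) ≤ 10 = 1·1 + 3·3` outputs — an OUTPUT-PERFECT certificate over every field.
[cite: Schonhage1981, §5] [cite: Pan1984, §16] -/
theorem readout_schoenhageE3 {F : SpectralMap K} (hF : IsUniversalSpectralPoint K F) :
    F (matMulTensor K 1 4 1) + F (matMulTensor K 3 1 3) ≤ 10 := by
  classical
  obtain ⟨H, u, v, w, d, hreal, hd, himp⟩ := FarEdgeDescentIsolatedTower.base_isolated K
  have hbr : algBorderRank (matMulDirectSum K (Fin.cons 1 (fun _ : Fin 1 => 3))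
      (Fin.cons 4 (fun _ : Fin 1 => 1)) (Fin.cons 1 (fun _ : Fin 1 => 3))) ≤ 3 * 3 + 1 :=
    FarEdgeDescentIsolatedSquare.algBorderRank_le_of_isolated K ⟨u, v, w, d, hreal, hd, himp⟩
  have h := sum_map_le_of_algBorderRank_le hF _ _ _ hbr
  rw [Fin.sum_univ_succ, Fin.sum_univ_one] at h
  have h' : F (matMulTensor K 1 4 1) + F (matMulTensor K 3 1 3) ≤ ((3 * 3 + 1 : ℕ) : ℝ) := h
  exact h'.trans_eq (by norm_num)

/-- **THE `E₃` ROOF**: `(log 4)·θ₁ ≤ (9 log 3)·(ε₀ + ε₂)` for every universal spectral point over every field (output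
weights `1/10`, `9/10`; shape `A = C = 9 log 3`, `B = log 4`). [cite: Schonhage1981, §5]
[cite: Coppersmith1982, Theorem (BCS 1997 Thm. (15.51))] -/
theorem roof_schoenhageE3 {F : SpectralMap K} (hF : IsUniversalSpectralPoint K F) :
    Real.log 4 * specMMPoint K F 1 ≤ 9 * Real.log 3 * ((1 - specMMPoint K F 0) + (1 - specMMPoint K F 2)) := by
  have hpos : ∀ i : Fin 2, 1 ≤ (![1, 3] : Fin 2 → ℕ) i ∧ 1 ≤ (![4, 1] : Fin 2 → ℕ) i ∧
      1 ≤ (![1, 3] : Fin 2 → ℕ) i := by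
    intro i
    fin_cases i <;> simp
  have hread : ∀ G : SpectralMap K, IsUniversalSpectralPoint K G →
      ∑ i : Fin 2, G (matMulTensor K ((![1, 3] : Fin 2 → ℕ) i) ((![4, 1] : Fin 2 → ℕ) i)
        ((![1, 3] : Fin 2 → ℕ) i)) ≤ ∑ i : Fin 2, (((![1, 3] : Fin 2 → ℕ) i : ℕ) : ℝ) * ((![1, 3] : Fin 2 → ℕ) i : ℕ) := by
    intro G hG
    have h := readout_schoenhageE3 hG
    simp only [Fin.sum_univ_two, Matrix.cons_val_zero, Matrix.cons_val_one]
    norm_num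
    exact h
  have h := weightedRoof_of_perfectReadout hpos (by norm_num) hread hF
  simp only [Fin.sum_univ_two, Matrix.cons_val_zero, Matrix.cons_val_one, Nat.cast_one, Nat.cast_ofNat,
    Real.log_one, mul_zero, add_zero, zero_add, one_mul] at h
  linarith

/-- **THE `E₃` PLATEAU**: `ω_K(1, log 4/(9 log 3), 1) = 2` over every field — dual exponent `≥ log 4/(9 log 3) = 0.1402…`
from a ten-product output-perfect packing (an illustration of §1–§2 on a certificate already in the tree; the tree's
Coppersmith value `0.1722` is larger). [cite: Schonhage1981, §5] [cite: Coppersmith1982, Theorem (BCS 1997 Thm. (15.51))] -/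
theorem plateau_schoenhageE3 : omegaRect K 1 (Real.log 4 / (9 * Real.log 3)) 1 = 2 := by
  have h9 : 0 < 9 * Real.log 3 := by have := Real.log_pos (show (1 : ℝ) < 3 by norm_num); positivity
  rw [plateau_iff_roof (div_nonneg (Real.log_nonneg (by norm_num)) h9.le)]
  intro F hF
  have h := roof_schoenhageE3 hF
  rw [div_mul_eq_mul_div, div_le_iff₀ h9]
  linarith

end Summit.MatrixMultiplication.MatrixMultiplication.Theorems.SaturationLadderPerfectPacking

end
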